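import Mathlib
import Literature.NumberTheory.Transcendental.KZCalculusProofs
import Literature.NumberTheory.Transcendental.SemialgebraicMapsProofs
import Literature.NumberTheory.Transcendental.KZSemialgebraicComplex
import Literature.NumberTheory.Transcendental.KZLogCalculusProofs
import Literature.NumberTheory.Transcendental.KZIdealTetrahedron
import HarnessLib

/-!
# `OffTetraSectorKernel`, line `deform-to-the-oracle`: the shadow square (algebra of stub `stub_shadowSquare`)

Stub `stub_shadowSquare` of the crux `OffTetraSectorKernel` (stmt-KontsevichZagierPeriods-10557, route
HyperbolicBloch) identifies the flat shadow of the ideal tetrahedron `T(i) = T(∞,0,1,i)` — the triangle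
`Δ(0,1,i) = {q₀ > 0, q₁ > 0, q₀ + q₁ < 1}` with the density `1/(2(q₀ + q₁ − q₀² − q₁²))` left by the cusp
descent `tetraFlatten` — with the SHADOW SQUARE `[[0,1)×(0,1), 1/(2 − a(1+s²))]` (value: Catalan's constant
`G = D(i)`). This file is the algebra of the two changes of variables used there:

* the FAN MAP `Λ(a,s) = (a(1+s)/2, a(1−s)/2)` of the rectangle `(0,1)×(−1,1)` onto the triangle
  (`a = q₀ + q₁`, `s = (q₀ − q₁)/(q₀ + q₁)`; derivative `[[ (1+s)/2, a/2 ], [ (1−s)/2, −a/2 ]]`, determinant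
  `−a/2`), with the Jacobian identity `1/(2(2 − a(1+s²))) = (a/2)·1/(2(q₀+q₁−q₀²−q₁²))∘Λ`
  (`q₀+q₁−q₀²−q₁² = a(2 − a(1+s²))/2`);
* the REFLECTION `(a,s) ↦ (a,−s)` (determinant `−1`), under which `1/(2(2 − a(1+s²)))` is invariant;

and the semialgebraicity of the rectangle pieces and densities. References: J. Milnor, *Hyperbolic geometry:
the first 150 years* (1982), Appendix; M. Kontsevich, D. Zagier, *Periods* (2001), §1.2.
-/

noncomputable section

open Set MeasureTheory MvPolynomial
open Literature.NumberTheory.Transcendental Literature.ModelTheory.ExponentialFields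

namespace Summit.KontsevichZagierPeriods.HyperbolicBloch.OffTetraSectorKernel

/-! ## Semialgebraic pieces -/

/-- A coordinate strict lower bound by a rational constant is `ℚ`-semialgebraic. [folklore] -/
theorem shadowSq_isSemialgebraic_const_lt (c : ℚ) (i : Fin 2) :
    IsSemialgebraic ℚ {x : Fin 2 → ℝ | (c : ℝ) < x i} :=
  isSemialgebraic_setOf_lt_of_isSemialgebraicFunOn
    (isSemialgebraicFunOn_const_of_isAlgebraic isSemialgebraic_univ (isAlgebraic_algebraMap c))
    ((isSemialgebraicFunOn_aeval isSemialgebraic_univ (X i)).congr fun w _ => by simp)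

/-- A coordinate strict upper bound by a rational constant is `ℚ`-semialgebraic. [folklore] -/
theorem shadowSq_isSemialgebraic_lt_const (c : ℚ) (i : Fin 2) :
    IsSemialgebraic ℚ {x : Fin 2 → ℝ | x i < (c : ℝ)} :=
  isSemialgebraic_setOf_lt_of_isSemialgebraicFunOn
    ((isSemialgebraicFunOn_aeval isSemialgebraic_univ (X i)).congr fun w _ => by simp)
    (isSemialgebraicFunOn_const_of_isAlgebraic isSemialgebraic_univ (isAlgebraic_algebraMap c))

/-- A coordinate non-strict lower bound by a rational constant is `ℚ`-semialgebraic. [folklore] -/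
theorem shadowSq_isSemialgebraic_const_le (c : ℚ) (i : Fin 2) :
    IsSemialgebraic ℚ {x : Fin 2 → ℝ | (c : ℝ) ≤ x i} := by
  convert (shadowSq_isSemialgebraic_lt_const c i).compl using 1
  ext x
  simp [not_lt]

/-- The rectangle `(0,1)×(−1,1)` is `ℚ`-semialgebraic. [folklore] -/
theorem shadowSq_isSemialgebraic_rect :
    IsSemialgebraic ℚ {x : Fin 2 → ℝ | 0 < x 0 ∧ x 0 < 1 ∧ -1 < x 1 ∧ x 1 < 1} := by
  convert ((shadowSq_isSemialgebraic_const_lt 0 0).inter (shadowSq_isSemialgebraic_lt_const 1 0)).inter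
    ((shadowSq_isSemialgebraic_const_lt (-1) 1).inter (shadowSq_isSemialgebraic_lt_const 1 1)) using 1
  ext x
  simp [and_assoc]

/-- The lower half `(0,1)×(−1,0)` of the rectangle is `ℚ`-semialgebraic. [folklore] -/
theorem shadowSq_isSemialgebraic_lower :
    IsSemialgebraic ℚ {x : Fin 2 → ℝ | 0 < x 0 ∧ x 0 < 1 ∧ -1 < x 1 ∧ x 1 < 0} := by
  convert ((shadowSq_isSemialgebraic_const_lt 0 0).inter (shadowSq_isSemialgebraic_lt_const 1 0)).inter
    ((shadowSq_isSemialgebraic_const_lt (-1) 1).inter (shadowSq_isSemialgebraic_lt_const 0 1)) using 1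
  ext x
  simp [and_assoc]

/-- The open unit square is `ℚ`-semialgebraic. [folklore] -/
theorem shadowSq_isSemialgebraic_sq :
    IsSemialgebraic ℚ {x : Fin 2 → ℝ | 0 < x 0 ∧ x 0 < 1 ∧ 0 < x 1 ∧ x 1 < 1} := by
  convert ((shadowSq_isSemialgebraic_const_lt 0 0).inter (shadowSq_isSemialgebraic_lt_const 1 0)).inter
    ((shadowSq_isSemialgebraic_const_lt 0 1).inter (shadowSq_isSemialgebraic_lt_const 1 1)) using 1
  ext x
  simp [and_assoc]

/-- The half-closed square `[0,1)×(0,1)` is `ℚ`-semialgebraic. [folklore] -/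
theorem shadowSq_isSemialgebraic_halfClosed :
    IsSemialgebraic ℚ {x : Fin 2 → ℝ | 0 ≤ x 0 ∧ x 0 < 1 ∧ 0 < x 1 ∧ x 1 < 1} := by
  convert ((shadowSq_isSemialgebraic_const_le 0 0).inter (shadowSq_isSemialgebraic_lt_const 1 0)).inter
    ((shadowSq_isSemialgebraic_const_lt 0 1).inter (shadowSq_isSemialgebraic_lt_const 1 1)) using 1
  ext x
  simp [and_assoc]

/-- On the closed-open slab `{0 ≤ a < 1, −1 < s < 1}` the shadow-square denominator is positive:
`a(1 + s²) < 2`. [folklore] -/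
theorem shadowSq_den_pos {a s : ℝ} (ha0 : 0 ≤ a) (ha1 : a < 1) (hs0 : -1 < s) (hs1 : s < 1) :
    0 < 2 - a * (1 + s ^ 2) := by
  have hs : s ^ 2 < 1 := by nlinarith
  have h1 : a * (1 + s ^ 2) ≤ a * 2 := mul_le_mul_of_nonneg_left (by linarith) ha0
  nlinarith

/-- The shadow-square density `1/(2 − a(1+s²))` is a `ℚ`-semialgebraic function on every `ℚ`-semialgebraic
`σ ⊆ {0 ≤ a < 1, −1 < s < 1}`. [cite: KontsevichZagier2001, §1.1] -/
theorem shadowSq_isSemialgebraicFunOn_density {σ : Set (Fin 2 → ℝ)} (hσ : IsSemialgebraic ℚ σ)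
    (hsub : ∀ x ∈ σ, 0 ≤ x 0 ∧ x 0 < 1 ∧ -1 < x 1 ∧ x 1 < 1) :
    IsSemialgebraicFunOn ℚ σ (fun x => 1 / (2 - x 0 * (1 + x 1 ^ 2))) := by
  have s0 : IsSemialgebraicFunOn ℚ σ (fun w => w 0) :=
    (isSemialgebraicFunOn_aeval hσ (X 0)).congr fun w _ => by simp
  have s1 : IsSemialgebraicFunOn ℚ σ (fun w => w 1) :=
    (isSemialgebraicFunOn_aeval hσ (X 1)).congr fun w _ => by simp
  have sone : IsSemialgebraicFunOn ℚ σ (fun _ => (1 : ℝ)) := by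
    simpa using isSemialgebraicFunOn_natCast (k := ℚ) (R := ℝ) hσ 1
  have stwo : IsSemialgebraicFunOn ℚ σ (fun _ => (2 : ℝ)) := by
    simpa using isSemialgebraicFunOn_natCast (k := ℚ) (R := ℝ) hσ 2
  have sden : IsSemialgebraicFunOn ℚ σ (fun x => 2 - x 0 * (1 + x 1 ^ 2)) := by
    refine (IsSemialgebraicFunOn.sub_holds stwo (IsSemialgebraicFunOn.mul_holds s0
      (IsSemialgebraicFunOn.add_holds sone (IsSemialgebraicFunOn.mul_holds s1 s1)))).congr fun x _ => ?_
    simp only [Pi.mul_apply, Pi.add_apply, Pi.sub_apply]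
    ring
  exact IsSemialgebraicFunOn.div sone sden fun x hx => by
    obtain ⟨h0, h1, h2, h3⟩ := hsub x hx
    exact (shadowSq_den_pos h0 h1 h2 h3).ne'

/-- The half density `1/(2(2 − a(1+s²)))` is a `ℚ`-semialgebraic function on every `ℚ`-semialgebraic
`σ ⊆ {0 ≤ a < 1, −1 < s < 1}`. [cite: KontsevichZagier2001, §1.1] -/
theorem shadowSq_isSemialgebraicFunOn_halfDensity {σ : Set (Fin 2 → ℝ)} (hσ : IsSemialgebraic ℚ σ)
    (hsub : ∀ x ∈ σ, 0 ≤ x 0 ∧ x 0 < 1 ∧ -1 < x 1 ∧ x 1 < 1) :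
    IsSemialgebraicFunOn ℚ σ (fun x => 1 / (2 * (2 - x 0 * (1 + x 1 ^ 2)))) := by
  have s0 : IsSemialgebraicFunOn ℚ σ (fun w => w 0) :=
    (isSemialgebraicFunOn_aeval hσ (X 0)).congr fun w _ => by simp
  have s1 : IsSemialgebraicFunOn ℚ σ (fun w => w 1) :=
    (isSemialgebraicFunOn_aeval hσ (X 1)).congr fun w _ => by simp
  have sone : IsSemialgebraicFunOn ℚ σ (fun _ => (1 : ℝ)) := by
    simpa using isSemialgebraicFunOn_natCast (k := ℚ) (R := ℝ) hσ 1
  have stwo : IsSemialgebraicFunOn ℚ σ (fun _ => (2 : ℝ)) := by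
    simpa using isSemialgebraicFunOn_natCast (k := ℚ) (R := ℝ) hσ 2
  have sden : IsSemialgebraicFunOn ℚ σ (fun x => 2 * (2 - x 0 * (1 + x 1 ^ 2))) := by
    refine (IsSemialgebraicFunOn.mul_holds stwo (IsSemialgebraicFunOn.sub_holds stwo
      (IsSemialgebraicFunOn.mul_holds s0 (IsSemialgebraicFunOn.add_holds sone
        (IsSemialgebraicFunOn.mul_holds s1 s1))))).congr fun x _ => ?_
    simp only [Pi.mul_apply, Pi.add_apply, Pi.sub_apply]
    ring
  exact IsSemialgebraicFunOn.div sone sden fun x hx => by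
    obtain ⟨h0, h1, h2, h3⟩ := hsub x hx
    exact (mul_pos two_pos (shadowSq_den_pos h0 h1 h2 h3)).ne'

/-! ## The triangle `Δ(0,1,i)` and its flat density, unfolded at `z = i` -/

/-- At `z = i` the pinned flat triangle `{q₁ > 0, Re z·q₁ < Im z·q₀, Im z·(q₀ − 1) < (Re z − 1)·q₁}` is
`{q₀ > 0, q₁ > 0, q₀ + q₁ < 1}`. [folklore] -/
theorem flatTriangle_I_eq :
    {q : Fin 2 → ℝ | 0 < q 1 ∧ Complex.I.re * q 1 < Complex.I.im * q 0 ∧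
      Complex.I.im * (q 0 - 1) < (Complex.I.re - 1) * q 1} =
    {q : Fin 2 → ℝ | 0 < q 0 ∧ 0 < q 1 ∧ q 0 + q 1 < 1} := by
  ext q
  simp only [mem_setOf_eq, Complex.I_re, Complex.I_im, zero_mul, one_mul, zero_sub, neg_mul]
  constructor
  · rintro ⟨h1, h0, h2⟩
    exact ⟨h0, h1, by linarith⟩
  · rintro ⟨h0, h1, h2⟩
    exact ⟨h1, h0, by linarith⟩

/-- At `z = i` the pinned flat density `Im z/(2(Im z (q₀ − q₀² − q₁²) + (|z|² − Re z) q₁))` is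
`1/(2(q₀ − q₀² − q₁² + q₁))`. [folklore] -/
theorem flatDensity_I_eq (q : Fin 2 → ℝ) :
    Complex.I.im / (2 * (Complex.I.im * (q 0 - q 0 ^ 2 - q 1 ^ 2) +
      (Complex.normSq Complex.I - Complex.I.re) * q 1)) = 1 / (2 * (q 0 - q 0 ^ 2 - q 1 ^ 2 + q 1)) := by
  simp [Complex.normSq_I]

/-! ## The fan map `Λ(a,s) = (a(1+s)/2, a(1−s)/2)` -/

/-- Coordinates of the fan map. [folklore] -/
theorem fan_apply (Λ : (Fin 2 → ℝ) → (Fin 2 → ℝ))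
    (hΛ : ∀ v, Λ v = ![v 0 * (1 + v 1) / 2, v 0 * (1 - v 1) / 2]) (v : Fin 2 → ℝ) :
    Λ v 0 = v 0 * (1 + v 1) / 2 ∧ Λ v 1 = v 0 * (1 - v 1) / 2 := by
  rw [hΛ]
  exact ⟨rfl, rfl⟩

/-- **The fan map sends the rectangle `(0,1)×(−1,1)` onto the triangle `{q₀ > 0, q₁ > 0, q₀ + q₁ < 1}`**
(inverse `a = q₀ + q₁`, `s = (q₀ − q₁)/(q₀ + q₁)`). [folklore] -/
theorem fan_image : ∀ (Λ : (Fin 2 → ℝ) → (Fin 2 → ℝ)), (∀ v, Λ v = ![v 0 * (1 + v 1) / 2, v 0 * (1 - v 1) / 2]) → Λ '' {x : Fin 2 → ℝ | 0 < x 0 ∧ x 0 < 1 ∧ -1 < x 1 ∧ x 1 < 1} = {q : Fin 2 → ℝ | 0 < q 0 ∧ 0 < q 1 ∧ q 0 + q 1 < 1} := by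
  intro Λ hΛ
  ext q
  constructor
  · rintro ⟨v, ⟨h0, h1, hs0, hs1⟩, rfl⟩
    obtain ⟨e0, e1⟩ := fan_apply Λ hΛ v
    simp only [mem_setOf_eq, e0, e1]
    refine ⟨by nlinarith, by nlinarith, by nlinarith⟩
  · rintro ⟨h0, h1, h2⟩
    have hsum : 0 < q 0 + q 1 := by linarith
    refine ⟨![q 0 + q 1, (q 0 - q 1) / (q 0 + q 1)], ?_, ?_⟩
    · simp only [mem_setOf_eq, Matrix.cons_val_zero, Matrix.cons_val_one, Matrix.cons_val_fin_one]
      refine ⟨hsum, h2, ?_, ?_⟩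
      · rw [lt_div_iff₀ hsum]; linarith
      · rw [div_lt_iff₀ hsum]; linarith
    · rw [hΛ]
      funext i
      fin_cases i
      · simp only [Fin.zero_eta, Fin.isValue, Matrix.cons_val_zero, Matrix.cons_val_one,
          Matrix.cons_val_fin_one]
        field_simp
        ring
      · simp only [Fin.mk_one, Fin.isValue, Matrix.cons_val_one, Matrix.cons_val_zero,
          Matrix.cons_val_fin_one]
        field_simp
        ring

/-- The fan map is injective on `{a ≠ 0}` (`a = q₀ + q₁`, then `s = (q₀ − q₁)/a`). [folklore] -/
theorem fan_injOn (Λ : (Fin 2 → ℝ) → (Fin 2 → ℝ))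
    (hΛ : ∀ v, Λ v = ![v 0 * (1 + v 1) / 2, v 0 * (1 - v 1) / 2]) :
    InjOn Λ {x : Fin 2 → ℝ | 0 < x 0 ∧ x 0 < 1 ∧ -1 < x 1 ∧ x 1 < 1} := by
  intro v hv v' hv' h
  obtain ⟨e0, e1⟩ := fan_apply Λ hΛ v
  obtain ⟨e0', e1'⟩ := fan_apply Λ hΛ v'
  have h0 : Λ v 0 = Λ v' 0 := by rw [h]
  have h1 : Λ v 1 = Λ v' 1 := by rw [h]
  rw [e0, e0'] at h0
  rw [e1, e1'] at h1
  have ha : v 0 = v' 0 := by linarith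
  have hva : v 0 ≠ 0 := hv.1.ne'
  have hs : v 0 * v 1 = v 0 * v' 1 := by rw [ha] at h0 h1 ⊢; linarith
  have hs' : v 1 = v' 1 := mul_left_cancel₀ hva hs
  funext i
  fin_cases i
  · exact ha
  · exact hs'

/-- The fan map is `ℚ`-semialgebraic on every `ℚ`-semialgebraic set (polynomial coordinates).
[cite: KontsevichZagier2001, §1.1] -/
theorem fan_isSemialgebraicMapOn (Λ : (Fin 2 → ℝ) → (Fin 2 → ℝ))
    (hΛ : ∀ v, Λ v = ![v 0 * (1 + v 1) / 2, v 0 * (1 - v 1) / 2]) {σ : Set (Fin 2 → ℝ)}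
    (hσ : IsSemialgebraic ℚ σ) : IsSemialgebraicMapOn ℚ σ Λ := by
  have s0 : IsSemialgebraicFunOn ℚ σ (fun w => w 0) :=
    (isSemialgebraicFunOn_aeval hσ (X 0)).congr fun w _ => by simp
  have s1 : IsSemialgebraicFunOn ℚ σ (fun w => w 1) :=
    (isSemialgebraicFunOn_aeval hσ (X 1)).congr fun w _ => by simp
  have sone : IsSemialgebraicFunOn ℚ σ (fun _ => (1 : ℝ)) := by
    simpa using isSemialgebraicFunOn_natCast (k := ℚ) (R := ℝ) hσ 1
  have shalf : IsSemialgebraicFunOn ℚ σ (fun _ => (2⁻¹ : ℝ)) := by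
    refine isSemialgebraicFunOn_const_of_isAlgebraic hσ ?_
    exact (isAlgebraic_nat 2).inv
  refine IsSemialgebraicMapOn.of_forall hσ fun j => ?_
  fin_cases j
  · refine (IsSemialgebraicFunOn.mul_holds (IsSemialgebraicFunOn.mul_holds s0
      (IsSemialgebraicFunOn.add_holds sone s1)) shalf).congr fun w _ => ?_
    simp [hΛ]
    ring
  · refine (IsSemialgebraicFunOn.mul_holds (IsSemialgebraicFunOn.mul_holds s0
      (IsSemialgebraicFunOn.sub_holds sone s1)) shalf).congr fun w _ => ?_
    simp [hΛ]
    ring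

/-- **The derivative of the fan map and its determinant**: matrix `[[ (1+s)/2, a/2 ], [ (1−s)/2, −a/2 ]]`,
determinant `−a/2`. [folklore] -/
theorem fan_hasFDerivAt_det (Λ : (Fin 2 → ℝ) → (Fin 2 → ℝ))
    (hΛ : ∀ v, Λ v = ![v 0 * (1 + v 1) / 2, v 0 * (1 - v 1) / 2]) (v : Fin 2 → ℝ) :
    ∃ L : (Fin 2 → ℝ) →L[ℝ] (Fin 2 → ℝ), HasFDerivAt Λ L v ∧ L.det = -(v 0) / 2 := by
  set M : Matrix (Fin 2) (Fin 2) ℝ := !![(1 + v 1) / 2, v 0 / 2; (1 - v 1) / 2, -(v 0) / 2] with hM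
  refine ⟨LinearMap.toContinuousLinearMap (Matrix.toLin' M), ?_, ?_⟩
  · have e0 : HasFDerivAt (fun x : Fin 2 → ℝ => x 0) (ContinuousLinearMap.proj 0) v :=
      hasFDerivAt_apply (𝕜 := ℝ) 0 v
    have e1 : HasFDerivAt (fun x : Fin 2 → ℝ => x 1) (ContinuousLinearMap.proj 1) v :=
      hasFDerivAt_apply (𝕜 := ℝ) 1 v
    have h0 : HasFDerivAt (fun x => Λ x 0)
        ((ContinuousLinearMap.proj 0).comp (LinearMap.toContinuousLinearMap (Matrix.toLin' M))) v := by
      have hf : (fun x => Λ x 0) = fun x : Fin 2 → ℝ => x 0 * (1 + x 1) * 2⁻¹ := by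
        funext x
        rw [(fan_apply Λ hΛ x).1]
        ring
      rw [hf]
      have hcomp := (e0.fun_mul (e1.const_add 1)).mul_const (2⁻¹ : ℝ)
      refine hcomp.congr_fderiv (ContinuousLinearMap.ext fun u => ?_)
      simp [hM, Matrix.toLin'_apply, dotProduct, Fin.sum_univ_two]
      ring
    have h1 : HasFDerivAt (fun x => Λ x 1)
        ((ContinuousLinearMap.proj 1).comp (LinearMap.toContinuousLinearMap (Matrix.toLin' M))) v := by
      have hf : (fun x => Λ x 1) = fun x : Fin 2 → ℝ => x 0 * (1 - x 1) * 2⁻¹ := by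
        funext x
        rw [(fan_apply Λ hΛ x).2]
        ring
      rw [hf]
      have hcomp := (e0.fun_mul (e1.const_sub 1)).mul_const (2⁻¹ : ℝ)
      refine hcomp.congr_fderiv (ContinuousLinearMap.ext fun u => ?_)
      simp [hM, Matrix.toLin'_apply, dotProduct, Fin.sum_univ_two]
      ring
    refine hasFDerivAt_pi'' fun i => ?_
    fin_cases i
    exacts [h0, h1]
  · rw [LinearMap.det_toContinuousLinearMap, LinearMap.det_toLin', Matrix.det_fin_two]
    simp [hM]
    ring

/-- `q₀ + q₁ − q₀² − q₁²` along the fan map: `a(2 − a(1+s²))/2`. [folklore] -/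
theorem fan_pow (a s : ℝ) :
    a * (1 + s) / 2 - (a * (1 + s) / 2) ^ 2 - (a * (1 - s) / 2) ^ 2 + a * (1 - s) / 2 =
      a * (2 - a * (1 + s ^ 2)) / 2 := by
  ring

/-- **Fan-map move data**: a derivative at every point and, on `{a > 0, a(1+s²) < 2}`, the Jacobian identity
`1/(2(2 − a(1+s²))) = 1/(2(q₀ + q₁ − q₀² − q₁²))|_{q = Λ(a,s)} · |det DΛ|` (`|det DΛ| = a/2`).
[cite: KontsevichZagier2001, §1.2 rule (2)] -/
theorem fan_moveData (Λ : (Fin 2 → ℝ) → (Fin 2 → ℝ))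
    (hΛ : ∀ v, Λ v = ![v 0 * (1 + v 1) / 2, v 0 * (1 - v 1) / 2]) :
    ∃ Λ' : (Fin 2 → ℝ) → ((Fin 2 → ℝ) →L[ℝ] (Fin 2 → ℝ)), ∀ v, HasFDerivAt Λ (Λ' v) v ∧
      |(Λ' v).det| = |v 0| / 2 ∧
      (0 < v 0 → 0 < 2 - v 0 * (1 + v 1 ^ 2) →
        1 / (2 * (2 - v 0 * (1 + v 1 ^ 2))) =
          1 / (2 * (Λ v 0 - Λ v 0 ^ 2 - Λ v 1 ^ 2 + Λ v 1)) * |(Λ' v).det|) := by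
  choose L hL using fan_hasFDerivAt_det Λ hΛ
  refine ⟨L, fun v => ⟨(hL v).1, ?_, ?_⟩⟩
  · rw [(hL v).2, abs_div, abs_neg, abs_two]
  · intro ha hden
    obtain ⟨e0, e1⟩ := fan_apply Λ hΛ v
    rw [(hL v).2, e0, e1, fan_pow, abs_div, abs_neg, abs_two, abs_of_pos ha]
    field_simp

/-! ## The reflection `(a,s) ↦ (a,−s)` -/

/-- The reflection `(a, s) ↦ (a, −s)` as a continuous linear map of determinant `−1`, its own derivative.
[folklore] -/
theorem reflect_data :
    ∃ R : (Fin 2 → ℝ) →L[ℝ] (Fin 2 → ℝ), (∀ v, R v = ![v 0, -(v 1)]) ∧ R.det = -1 ∧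
      ∀ v, HasFDerivAt (fun x : Fin 2 → ℝ => ![x 0, -(x 1)]) R v := by
  set M : Matrix (Fin 2) (Fin 2) ℝ := !![1, 0; 0, -1] with hM
  refine ⟨LinearMap.toContinuousLinearMap (Matrix.toLin' M), ?_, ?_, ?_⟩
  · intro v
    funext i
    fin_cases i <;> simp [hM, Matrix.toLin'_apply, dotProduct, Fin.sum_univ_two]
  · rw [LinearMap.det_toContinuousLinearMap, LinearMap.det_toLin', Matrix.det_fin_two]
    simp [hM]
  · intro v
    have h := (LinearMap.toContinuousLinearMap (Matrix.toLin' M)).hasFDerivAt (x := v)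
    refine h.congr_of_eventuallyEq (Filter.Eventually.of_forall fun x => ?_)
    funext i
    fin_cases i <;> simp [hM, Matrix.toLin'_apply, dotProduct, Fin.sum_univ_two]

/-- The reflection maps the lower half-rectangle `(0,1)×(−1,0)` onto the upper one `(0,1)×(0,1)`. [folklore] -/
theorem reflect_image :
    (fun x : Fin 2 → ℝ => ![x 0, -(x 1)]) '' {x : Fin 2 → ℝ | 0 < x 0 ∧ x 0 < 1 ∧ -1 < x 1 ∧ x 1 < 0} =
      {x : Fin 2 → ℝ | 0 < x 0 ∧ x 0 < 1 ∧ 0 < x 1 ∧ x 1 < 1} := by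
  ext w
  simp only [mem_image, mem_setOf_eq]
  constructor
  · rintro ⟨v, ⟨h0, h1, h2, h3⟩, rfl⟩
    simp only [Matrix.cons_val_zero, Matrix.cons_val_one, Matrix.cons_val_fin_one]
    exact ⟨h0, h1, by linarith, by linarith⟩
  · rintro ⟨h0, h1, h2, h3⟩
    refine ⟨![w 0, -(w 1)], ?_, ?_⟩
    · simp only [Matrix.cons_val_zero, Matrix.cons_val_one, Matrix.cons_val_fin_one]
      exact ⟨h0, h1, by linarith, by linarith⟩
    · funext i
      fin_cases i <;> simp

/-- The reflection is injective. [folklore] -/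
theorem reflect_injective : Function.Injective (fun x : Fin 2 → ℝ => ![x 0, -(x 1)]) := by
  intro v v' h
  have h0 := congrFun h 0
  have h1 := congrFun h 1
  simp only [Matrix.cons_val_zero, Matrix.cons_val_one, Matrix.cons_val_fin_one, neg_inj] at h0 h1
  funext i
  fin_cases i
  exacts [h0, h1]

/-- The reflection is a `ℚ`-semialgebraic map on every `ℚ`-semialgebraic set. [cite: KontsevichZagier2001, §1.1] -/
theorem reflect_isSemialgebraicMapOn {σ : Set (Fin 2 → ℝ)} (hσ : IsSemialgebraic ℚ σ) :
    IsSemialgebraicMapOn ℚ σ (fun x : Fin 2 → ℝ => ![x 0, -(x 1)]) := by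
  refine IsSemialgebraicMapOn.of_forall hσ fun j => ?_
  fin_cases j
  · exact (isSemialgebraicFunOn_aeval hσ (X 0)).congr fun w _ => by simp
  · exact (isSemialgebraicFunOn_aeval hσ (-X 1)).congr fun w _ => by simp

end Summit.KontsevichZagierPeriods.HyperbolicBloch.OffTetraSectorKernel

end
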